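/-
Copyright: the b2b-balaban T⁴-continuum CRUX team, row NE7b OWNER lineage `t4-ne7b-p1` (gen 134). Project licence.
-/
import Summits.QuantumFields.BalabanUV.T4Continuum.Spine.NE7b.SupPolymerLocalStep
import Summits.QuantumFields.BalabanUV.T4Continuum.Spine.NE7b.SupPolymerLocalSmallnessLinear
import Summits.QuantumFields.BalabanUV.T4Continuum.Spine.NE7b.SupPolymerLocalNextFactors

/-!
# THE ROAD'S STEP WITHOUT SQUARE ROOTS — EVERY ARROW LINEAR: (355) measured the shifted resummed activity `z_ψ` with (350)'s letter
# `ε′ = √ε″e^{2√ε″}`; with (357)'s weighted cover counting the same activity has the LINEAR letter `ε₁ := 2e(Δ+1)²·ε″`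
# (`ε″ = εe^{½κ(1+τ⁻¹)Ψ²}A_τ^v`, `0 < ε`, `2(Δ+1)²ε″ ≤ 1`), and (361) turns it into the pinned-norm bound of the next Mayer factors:
#   `Σ_{Y∈𝒫(⋃𝒳) touching {q}}‖e^{K⁺_Y(ψ)} − 1‖e^{τ₂#Y} ≤ 2(Δ+1)·((Δ+1)·2ε₁e^{1+τ₂})`
# — factor letter `ε` ↦ activity letter `ε₁` ↦ output norm, each step a constant times the previous one; with (367)'s blocked ledger the whole
# combinatorial chain of SCOPING-d6 is linear with explicit constants (row NE7b, node U5c; (355)∕(357)∕(361) BY NAME; [folklore])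

Cell `pub-balaban`, sub-cell `t4`, spine estimate NE7b (`T4WeightBudget.RelWeightBound`; the cell's OWN estimate — NOT PRINTED in
[Bałaban 1983–89], NOT PROVED).  Crux-route work under `Spine/NE7b/` by the row OWNER (`t4-ne7b-p1` gen 134, file (368)) under FREEZE
(0)'s crux-prover clause, on `g134/records/SCOPING-d6-iteration.md` (L1); NOTHING of Bałaban's is named as a Lean object, valued or asserted; no
`T4Continuum/Support` leaf typed; no `def`, no notation; zero `sorry`.  Imports (BY NAME): the OWNER's (355) `…SupPolymerLocalStep` (`shifted_activity_letter`),
(357) `…SupPolymerLocalSmallnessLinear` (`abs_pushforwardActivity_le_linear`), (361) `…SupPolymerLocalNextFactors` (`nextFactors_touchNorm_le`), (289)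
(`one_le_regulatorCost`).

WHAT IS PROVED ([folklore]): `eps''_pos` (`0 < ε″` for `0 < ε`), **`shifted_pushforward_letter_linear`** (`‖z_ψ(Y)‖ ≤ ε₁^{#Y}`, `ε₁ = 2e(Δ+1)²ε″`),
`admissible_of_decaySmallness` (`(Δ+1)²ε₁e^{1+τ₂} ≤ 1∕2 ⟹ 2(Δ+1)²ε″ ≤ 1`), THE END **`road_step_nextFactors_norm_le_linear`**; toy.

HONEST (what this is NOT).  Bookkeeping of constants (no new estimate); fixed small `ψ`; (L3)–(L5) of SCOPING-d6 untouched; scalar skeleton ((A3),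
NC-NE7b-α UNRULED); nothing of Bałaban's asserted.  BY-NAME EFFECT ON THE WALL: NONE.  NE7b NOT PRINTED ∕ NOT PROVED; spine PROVED 0∕9; rung (B)+1 —
the programme's measures remain FINITE-torus statements; NOT the mass gap, NOT Clay.  HONEST DEPENDENCY: continuum YM on T⁴ ⇐ BetaPertH ∧ nine spine
estimates (0∕9 proved); BetaPertH ⇐ (D1) ∧ (D4) ∧ CAP+tail; G-an2-4 gates asym, D1 and NE2∕3∕4.
-/

set_option autoImplicit false

noncomputable section

namespace Summit.QuantumFields.BalabanUV.T4Continuum.NE7b.SupPolymerLocalStepLinearLetter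

open MeasureTheory ProbabilityTheory Finset Real
open scoped BigOperators
open Literature.Probability.LatticeModels
open SupPolymerLocalStep (shifted_activity_letter)
open SupPolymerLocalSmallnessLinear (abs_pushforwardActivity_le_linear)
open SupPolymerLocalNextFactors (nextFactors_touchNorm_le)
open SupRegulatedActivityBound (one_le_regulatorCost)

variable {V : Type*} [DecidableEq V] {R : V → V → Prop} [DecidableRel R] {nbr : V → Finset V} {Δ : ℕ}
variable {ι : Type} [Fintype ι] [DecidableEq ι]

omit [DecidableEq V] [DecidableRel R] [Fintype ι] [DecidableEq ι] in
/-- `0 < ε″ = ε_Ψ·A_τ^v` for `0 < ε`. [folklore] -/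
theorem eps''_pos {ε κ τ θ Ψ γ : ℝ} {v : ℕ} (hε : 0 < ε) (hκ : 0 ≤ κ) (hτ : 0 < τ) (hγ : 0 ≤ γ) (hθ0 : 0 < θ) (hθ1 : θ < 1) :
    0 < (ε * exp (κ * (1 + τ⁻¹) * Ψ ^ 2 / 2)) * ((1 - θ) ^ (-(κ * (1 + τ) * γ / (2 * θ)))) ^ v := by
  have hκγ : 0 ≤ κ * (1 + τ) * γ := by positivity
  exact mul_pos (mul_pos hε (exp_pos _)) (pow_pos (lt_of_lt_of_le one_pos (one_le_regulatorCost hκγ hθ0 hθ1)) _)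

omit [DecidableRel R] in
/-- **THE LINEAR LETTER OF THE SHIFTED RESUMMED ACTIVITY**: under the hypotheses of (355)'s `shifted_activity_letter`, `0 < ε`, `R` symmetric with
`≤ Δ` neighbours, members of `𝒳` `R`-connected and `2(Δ+1)²ε″ ≤ 1` ⟹ `‖z_ψ(Y)‖ ≤ (2e(Δ+1)²ε″)^{#Y}` for every `Y`. [folklore] -/
theorem shifted_pushforward_letter_linear {Γ : Matrix ι ι ℝ} {γop γ : ℝ} (hΓ : Γ.PosSemidef) (hΓop : (γop • (1 : Matrix ι ι ℝ) - Γ).PosSemidef)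
    (hdiag : ∀ i, Γ i i ≤ γ) (hγ : 0 ≤ γ) (cell : V → Finset ι) (hdisj : ∀ p q, p ≠ q → Disjoint (cell p) (cell q)) {v : ℕ}
    (hv : ∀ p, (cell p).card ≤ v) (hRsymm : ∀ x y, R x y → R y x) (hΔ : ∀ x, (nbr x).card ≤ Δ) (hnbr : ∀ x y, R x y → y ∈ nbr x)
    {f : Finset V → EuclideanSpace ℝ ι → ℂ} {ε κ τ θ Ψ : ℝ} (hε : 0 < ε) (hκ : 0 ≤ κ) (hτ : 0 < τ)
    (hθ0 : 0 < θ) (hθ1 : θ < 1) (hκθ : κ * (1 + τ) * γop ≤ θ) (𝒳 : Finset (Finset V)) (hconn : ∀ X ∈ 𝒳, IsRConnected R X)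
    (hreg : ∀ X ∈ 𝒳, X.card = 1 → ∀ ω : EuclideanSpace ℝ ι, ‖f X ω‖ ≤ ε ^ X.card * exp (κ * (∑ x ∈ X.biUnion cell, ω x ^ 2) / 2))
    (hsup : ∀ X ∈ 𝒳, X.card ≠ 1 → ∀ ω : EuclideanSpace ℝ ι, ‖f X ω‖ ≤ ε ^ X.card) (ψ : EuclideanSpace ℝ ι)
    (hψ : ∀ X ∈ 𝒳, X.card = 1 → ∑ x ∈ X.biUnion cell, ψ x ^ 2 ≤ Ψ ^ 2)
    (hsmall : 2 * ((Δ : ℝ) + 1) ^ 2 * ((ε * exp (κ * (1 + τ⁻¹) * Ψ ^ 2 / 2)) * ((1 - θ) ^ (-(κ * (1 + τ) * γ / (2 * θ)))) ^ v) ≤ 1)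
    (Y : Finset V) :
    ‖pushforwardActivity (fun 𝒜 : Finset (Finset V) => 𝒜.biUnion id)
        (cellActivity (multivariateGaussian 0 Γ) fun X ω => f X (ω + ψ)) (rconnSubsets (Touches R) 𝒳) Y‖ ≤
      (2 * Real.exp 1 * ((Δ : ℝ) + 1) ^ 2 *
        ((ε * exp (κ * (1 + τ⁻¹) * Ψ ^ 2 / 2)) * ((1 - θ) ^ (-(κ * (1 + τ) * γ / (2 * θ)))) ^ v)) ^ Y.card :=
  abs_pushforwardActivity_le_linear hRsymm hΔ hnbr 𝒳 hconn (eps''_pos hε hκ hτ hγ hθ0 hθ1) hsmall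
    (shifted_activity_letter hΓ hΓop hdiag hγ cell hdisj hv hε.le hκ hτ hθ0 hθ1 hκθ 𝒳 hreg hsup ψ hψ) Y

omit [DecidableEq V] [DecidableRel R] [Fintype ι] [DecidableEq ι] in
/-- The decay smallness of the linear letter implies its admissibility: `0 ≤ ε″`, `0 ≤ τ₂`, `(Δ+1)²·(2e(Δ+1)²ε″)·e^{1+τ₂} ≤ 1∕2 ⟹ 2(Δ+1)²ε″ ≤ 1`.
[folklore] -/
theorem admissible_of_decaySmallness {ε'' τ₂ : ℝ} (hε : 0 ≤ ε'') (hτ₂ : 0 ≤ τ₂)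
    (hsmall : ((Δ : ℝ) + 1) ^ 2 * ((2 * Real.exp 1 * ((Δ : ℝ) + 1) ^ 2 * ε'') * Real.exp (1 + τ₂)) ≤ 1 / 2) :
    2 * ((Δ : ℝ) + 1) ^ 2 * ε'' ≤ 1 := by
  have hD1 : 1 ≤ ((Δ : ℝ) + 1) ^ 2 := by
    have : (0 : ℝ) ≤ Δ := Nat.cast_nonneg Δ
    nlinarith
  have he1 : 1 ≤ Real.exp 1 := Real.one_le_exp zero_le_one
  have he2 : 1 ≤ Real.exp (1 + τ₂) := Real.one_le_exp (by linarith)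
  have h0 : 0 ≤ 2 * ((Δ : ℝ) + 1) ^ 2 * ε'' := by positivity
  -- `x ≤ (Δ+1)²·(e·x)·e^{1+τ₂} ≤ 1/2`
  have h1 : 2 * ((Δ : ℝ) + 1) ^ 2 * ε'' ≤ ((Δ : ℝ) + 1) ^ 2 * ((2 * Real.exp 1 * ((Δ : ℝ) + 1) ^ 2 * ε'') * Real.exp (1 + τ₂)) := by
    calc 2 * ((Δ : ℝ) + 1) ^ 2 * ε'' ≤ 2 * Real.exp 1 * ((Δ : ℝ) + 1) ^ 2 * ε'' := by nlinarith
      _ ≤ (2 * Real.exp 1 * ((Δ : ℝ) + 1) ^ 2 * ε'') * Real.exp (1 + τ₂) := le_mul_of_one_le_right (by positivity) he2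
      _ ≤ ((Δ : ℝ) + 1) ^ 2 * ((2 * Real.exp 1 * ((Δ : ℝ) + 1) ^ 2 * ε'') * Real.exp (1 + τ₂)) :=
          le_mul_of_one_le_left (by positivity) hD1
  linarith

/-- **THE END — THE NEXT FACTORS' PINNED NORM WITH THE LINEAR LETTER.**  Under the hypotheses of `shifted_pushforward_letter_linear` (except that the
admissibility is implied), `0 ≤ τ₂`, `(Δ+1)²ε₁e^{1+τ₂} ≤ 1∕2` and `(Δ+1)·((Δ+1)·2ε₁e^{1+τ₂}) ≤ 1` with `ε₁ = 2e(Δ+1)²ε″` ⟹ for every cell `q`,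
`Σ_{Y∈𝒫(⋃𝒳) touching {q}}‖e^{K⁺_Y(ψ)} − 1‖e^{τ₂#Y} ≤ 2(Δ+1)·((Δ+1)·2ε₁e^{1+τ₂})`. [folklore] -/
theorem road_step_nextFactors_norm_le_linear {Γ : Matrix ι ι ℝ} {γop γ : ℝ} (hΓ : Γ.PosSemidef)
    (hΓop : (γop • (1 : Matrix ι ι ℝ) - Γ).PosSemidef) (hdiag : ∀ i, Γ i i ≤ γ) (hγ : 0 ≤ γ) (cell : V → Finset ι)
    (hdisj : ∀ p q, p ≠ q → Disjoint (cell p) (cell q)) {v : ℕ} (hv : ∀ p, (cell p).card ≤ v) (hRsymm : ∀ x y, R x y → R y x)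
    (hΔ : ∀ x, (nbr x).card ≤ Δ) (hnbr : ∀ x y, R x y → y ∈ nbr x)
    {f : Finset V → EuclideanSpace ℝ ι → ℂ} {ε κ τ θ Ψ : ℝ} (hε : 0 < ε) (hκ : 0 ≤ κ) (hτ : 0 < τ)
    (hθ0 : 0 < θ) (hθ1 : θ < 1) (hκθ : κ * (1 + τ) * γop ≤ θ) (𝒳 : Finset (Finset V)) (hconn : ∀ X ∈ 𝒳, IsRConnected R X)
    (hreg : ∀ X ∈ 𝒳, X.card = 1 → ∀ ω : EuclideanSpace ℝ ι, ‖f X ω‖ ≤ ε ^ X.card * exp (κ * (∑ x ∈ X.biUnion cell, ω x ^ 2) / 2))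
    (hsup : ∀ X ∈ 𝒳, X.card ≠ 1 → ∀ ω : EuclideanSpace ℝ ι, ‖f X ω‖ ≤ ε ^ X.card) (ψ : EuclideanSpace ℝ ι)
    (hψ : ∀ X ∈ 𝒳, X.card = 1 → ∑ x ∈ X.biUnion cell, ψ x ^ 2 ≤ Ψ ^ 2) {τ₂ : ℝ} (hτ₂ : 0 ≤ τ₂)
    (hsmall : ((Δ : ℝ) + 1) ^ 2 * ((2 * Real.exp 1 * ((Δ : ℝ) + 1) ^ 2 *
      ((ε * exp (κ * (1 + τ⁻¹) * Ψ ^ 2 / 2)) * ((1 - θ) ^ (-(κ * (1 + τ) * γ / (2 * θ)))) ^ v)) * Real.exp (1 + τ₂)) ≤ 1 / 2)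
    (hη1 : ((Δ : ℝ) + 1) * (((Δ : ℝ) + 1) * (2 * ((2 * Real.exp 1 * ((Δ : ℝ) + 1) ^ 2 *
      ((ε * exp (κ * (1 + τ⁻¹) * Ψ ^ 2 / 2)) * ((1 - θ) ^ (-(κ * (1 + τ) * γ / (2 * θ)))) ^ v)) * Real.exp (1 + τ₂)))) ≤ 1) (q : V) :
    ∑ Y ∈ rconnSubsets R (𝒳.biUnion id) with Touches R Y {q},
        ‖Complex.exp (∑ 𝒞 ∈ ((rconnSubsets (Touches R) 𝒳).image fun 𝒜 => 𝒜.biUnion id).powerset with 𝒞.biUnion id = Y,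
          truncatedWeight (GeomInc R) (pushforwardActivity (fun 𝒜 : Finset (Finset V) => 𝒜.biUnion id)
            (cellActivity (multivariateGaussian 0 Γ) fun X ω => f X (ω + ψ)) (rconnSubsets (Touches R) 𝒳)) 𝒞) - 1‖ * Real.exp (τ₂ * (Y.card : ℝ)) ≤
      2 * (((Δ : ℝ) + 1) * (((Δ : ℝ) + 1) * (2 * ((2 * Real.exp 1 * ((Δ : ℝ) + 1) ^ 2 *
        ((ε * exp (κ * (1 + τ⁻¹) * Ψ ^ 2 / 2)) * ((1 - θ) ^ (-(κ * (1 + τ) * γ / (2 * θ)))) ^ v)) * Real.exp (1 + τ₂))))) := by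
  have hε''0 : 0 ≤ (ε * exp (κ * (1 + τ⁻¹) * Ψ ^ 2 / 2)) * ((1 - θ) ^ (-(κ * (1 + τ) * γ / (2 * θ)))) ^ v :=
    (eps''_pos hε hκ hτ hγ hθ0 hθ1).le
  have hadm := admissible_of_decaySmallness (Δ := Δ) hε''0 hτ₂ hsmall
  have hz := shifted_pushforward_letter_linear hΓ hΓop hdiag hγ cell hdisj hv hRsymm hΔ hnbr hε hκ hτ hθ0 hθ1 hκθ 𝒳 hconn hreg hsup ψ hψ hadm
  exact nextFactors_touchNorm_le hRsymm hΔ hnbr 𝒳 hconn (by positivity) hτ₂ hz hsmall hη1 q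

/-! ## Toy -/

omit [DecidableEq V] [DecidableRel R] [Fintype ι] [DecidableEq ι] in
/-- Toy: with `v = 0` and `Ψ = 0` the parameter `ε″` is `ε·e^0·A^0 = ε > 0`. -/
example {ε κ τ θ γ : ℝ} (hε : 0 < ε) (hκ : 0 ≤ κ) (hτ : 0 < τ) (hγ : 0 ≤ γ) (hθ0 : 0 < θ) (hθ1 : θ < 1) :
    0 < (ε * exp (κ * (1 + τ⁻¹) * (0 : ℝ) ^ 2 / 2)) * ((1 - θ) ^ (-(κ * (1 + τ) * γ / (2 * θ)))) ^ 0 :=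
  eps''_pos hε hκ hτ hγ hθ0 hθ1

end Summit.QuantumFields.BalabanUV.T4Continuum.NE7b.SupPolymerLocalStepLinearLetter
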